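import Summits.ResolutionOfSingularities.ResolutionOfSingularities.Theorems.NoZeno.Negative.NoZenoValuativeSkeleton
import Summits.ResolutionOfSingularities.ResolutionOfSingularities.Theorems.NoZeno.Negative.NoZenoFalseWithoutFG

/-!
# Disproof of `NoZeno` (stmt-ResolutionOfSingularities-16483) — standing disprover's work file

Crux: `Summit.ResolutionOfSingularities.ResolutionOfSingularities.Theses.HomologicalConductor.NoZeno`
`= Persistence → StrictDrop → Termination` (valuative termination of the canonical normalised
`ca`-tower `T₀ = A_centre`, `T_(m+1) = (normalisation of T_m[ca(T_m)/x])_centre`, along EVERY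
valuation ring `O ∋ k` of `K = Frac A`, `A` f.g. over a field `k` of characteristic `p`).
Route `ResolutionOfSingularities/HomologicalConductor`; line `birth` (3 stubs: noetherian `O` /
rank-one non-discrete `O` / rank reduction). Cycle 1 (2026-08-17), cdisprove seat
`refuter-cdisprove-stmt-ResolutionOfSingularities-16483-0`.

## Findings (index; everything below is kernel-checked unless marked NEAR-MISS)

**F0 — no kill; the crux is unfalsifiable in isolation.** `not_noZeno_iff'`:
`¬ NoZeno ↔ Persistence ∧ StrictDrop ∧ ¬ Termination` (restated from
`Cruxes/NoZeno/CruxAttack.lean`, batch refuter). Any refutation must PROVE both sibling cruxes in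
full generality; a Zeno tower found in nature kills the ROUTE (via `Termination`, the antecedent
of `Globalisation`, or `SurfaceTermination` in dimension 2) but never lands on `NoZeno`. Hence
hypothesis surgery (`_false_without_`) is only meaningful on `Termination`; done in F2.

**F1 — LANDED `Theorems/NoZeno/Negative/NoZenoValuativeSkeleton.lean` (p152845): the ORDER
SKELETON of the crux holds exactly as far as `O` is noetherian.**
* `noZenoSkeleton_of_isNoetherianRing` (positive): along a noetherian `O`, for ANY badness
  predicate and WITHOUT monotonicity, the `StrictDrop` clause on sets `c m ⊆ O` forces a good
  stage (maximal principal ideal argument). = the whole order content of `stub_noetherianCase`.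
* `not_noZenoSkeleton_rankOne`: Zeno descent `γ_m = 2^{-m}` along the valuation ring of
  `HahnSeries ℚ ℚ` with `c m = t^(1/2^m)·O` — nested `O`-ideals with attained minima, dropping at
  every step, never containing `1`. ⇒ `stub_rankOneCase` cannot follow from `Persistence` and
  `StrictDrop` read as statements about the VALUES of `ca(T_m)`; it needs arithmetic of the ideals
  (bounded denominators of `γ_m`, i.e. control of the value semigroups `v(T_m ∖ 0)`).
* `not_noZenoSkeleton_discreteRankTwo`: same along `HahnSeries (ℤ ×ₗ ℤ) ℚ`, `γ_m = (1,-m)`: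
  a DISCRETE (f.g.) value group does not help; "discrete valuations are automatic" means
  NOETHERIAN `O`; `stub_rankReduction` has order-theoretic content in discrete rank two already.

**F1′ — LANDED `Theorems/NoZeno/Negative/NoZenoSkeletonIffNoetherian.lean` (p153802):
`noZenoSkeleton_iff_isNoetherianRing` — the strong order skeleton along `O` holds IFF `O` is
noetherian (every non-noetherian valuation ring has a strictly ascending chain of principal
ideals `(z m)`, a Zeno sequence). The birth line's cut (stub 1 | stubs 2–3) is exactly the
order/arithmetic boundary.

**F2 — LANDED `Theorems/NoZeno/Negative/NoZenoFalseWithoutFG.lean` (p153324): `A.FG` is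
load-bearing, and deleting it from the whole crux makes the crux vacuous.** Witness `A = O` = the
(non-noetherian, rank-one) valuation ring of `HahnSeries ℚ 𝔽₂`, admissible for every other datum
hypothesis: the verbatim `let`-tower is CONSTANT (`noZeno_tower_eq_self_of_valuationSubring` —
`loc` inverts `O`-units, `chart` generators lie in `O` by the admissibility clause ALONE, `nrm`
adds nothing; NOTHING about `ca` is used), so `noZeno_termination_false_without_fg`,
`noZeno_strictDrop_false_without_fg`, and `noZenoWithoutFG_holds_vacuously`.
Other datum hypotheses (paper, CruxAttack A5): `∀ c, algebraMap k K c ∈ O` redundant given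
`A ≤ O`; dropping `IsFractionRing`/`A ≤ O` de-natures `nrm`/`loc` without producing falsity;
`CharP`/`p.Prime`: the characteristic-zero analogue is EQUALLY OPEN (termination of THIS canonical
tower is not a consequence of Hironaka) — the crux is a new conjecture in every characteristic.

**F3 — birth-line stub 1 PROVED here (positive; evidence for the lead, not a landing):**
`tower_le` (`T_m ⊆ O` for the verbatim tower, needs only `k ⊆ O`, `A ⊆ O`) and
`stub_noetherianCase_proof : StrictDrop → (datum) → IsNoetherianRing O → ∃ m, T_m regular`
(let-form; `= Lines.Birth.Sig.stub_noetherianCase` up to unfolding `Birth.tower` and moving the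
hypothesis `IsNoetherianRing ↥O`). So the line's open content is exactly stubs 2–3, and by F1 both
need non-order-theoretic input.

**F4 — Targets.** `payload.targets = []`, `stuck_stubs = []` (lead not started). Stubs 2 and 3 of
`birth` inherit F0: `¬ stub_rankOneCase` and `¬ stub_rankReduction` each contain proofs of
`Persistence ∧ StrictDrop`; not attackable in isolation either.

## Why the crux resists (for ideators / the lead)

1. Formal: F0. 2. Mathematical: a kill of the ROUTE needs an infinite chain of singular local
rings `T₀ < T₁ < ⋯`, `T_(m+1)` a local ring of the normalised blow-up of `ca(T_m)` dominating
`T_m` (then SOME valuation ring realises it as its tower — CruxAttack S2(i)); but the exact ideal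
`ca` (not its radical: `V(ca) = Sing` is known, IyengarTakahashi2014 Thm 5.4) is computable today
only where the stable module category is under control (regular: `ca = R`; reduced Gorenstein
curves: conductor, Esentepe2018; ADE surfaces: the card's lists). On those the tower terminates
(card computations; curves: `CurveStep`). 3. Termination must use SPECIFIC properties of `ca`:
even on the `A₁` surface singularity, adversarially chosen complete 𝔪-primary centres give
non-terminating normalised blow-up towers (`A₁ → A₁ → ⋯`: on the minimal resolution blown up
twice, `D = 2E'' + 3F₁' + 6F₂` is anti-nef with `D·F₁' = 0`, so `NBl_I`, `I = π_*O(−D)`, contracts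
the `(−2)`-curve `F₁'` to a new `A₁` point) — paper argument, not formalised. 4. The one documented
LOOPING canonical tower (normalised Nash blow-up of a toric fourfold, CastilloEtAl2024) lives on
toric rings, where `ca` is a MONOMIAL ideal (canonical ⇒ torus-stable) and the whole `ca`-tower
along a monomial valuation is combinatorial — a genuine compute test-bed (`kit compute`, pure
python over semigroups) the moment a formula/algorithm for `ca(k[S])` of a normal affine semigroup
ring exists (none in print: arXiv "cohomology annihilator" 25 hits 2013–2025, none toric;
conic-module / Auslander-style description of MCM over simplicial toric = abelian quotient
singularities is the natural entry). Logged as the cheapest route-level falsifier.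

## Used from elsewhere
`Cruxes/NoZeno/CruxAttack.lean` (structural iff, degenerate slice `O = ⊤`, redundancy of `hk`),
`Lines/birth.lean` (stub statements), `Theorems/Globalisation/Negative/CuspCylinderCertificate.lean`
(ca does not localise — irrelevant to the LOCAL towers here, noted).
-/

set_option linter.dupNamespace false

noncomputable section

namespace Summit.ResolutionOfSingularities.ResolutionOfSingularities.Cruxes.NoZeno.Disproof

open Summit.ResolutionOfSingularities.ResolutionOfSingularities.Theses.HomologicalConductor
open Summit.ResolutionOfSingularities.ResolutionOfSingularities.Theorems.NoZeno.Negative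

/-! ## F0 — structural: the crux versus its conclusion -/

/-- Unconditional valuative termination (the conclusion of `NoZeno` verbatim; `= ∀ p prime,
antecedent of Globalisation p`; same as `CruxAttack.Termination`). [folklore] -/
def Termination : Prop :=
  ∀ p : ℕ, p.Prime → ∀ (k K : Type) [Field k] [CharP k p] [Field K] [Algebra k K] (O : ValuationSubring K) (A : Subalgebra k K), (∀ c : k, algebraMap k K c ∈ O) → A.FG → IsFractionRing ↥A K → A.toSubring ≤ O.toSubring → let ca : Subalgebra k K → Set K := fun A => {x : K | ∃ hx : x ∈ A, ∃ n : ℕ, ∀ i : ℕ, n ≤ i → ∀ (M N : ModuleCat.{0} ↥A), Module.Finite ↥A M → Module.Finite ↥A N → ∀ e : CategoryTheory.Abelian.Ext.{0} M N i, (⟨x, hx⟩ : ↥A) • e = 0}; let loc : Subalgebra k K → Subalgebra k K := fun A => Algebra.adjoin k {y : K | ∃ a ∈ A, ∃ s ∈ A, s⁻¹ ∈ O ∧ y = a * s⁻¹}; let chart : Subalgebra k K → Subalgebra k K := fun A => Algebra.adjoin k ((A : Set K) ∪ {y : K | ∃ c ∈ ca A, ∃ x ∈ ca A, x ≠ 0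 ∧ (∀ c' ∈ ca A, c' * x⁻¹ ∈ O) ∧ y = c * x⁻¹}); let nrm : Subalgebra k K → Subalgebra k K := fun B => Algebra.adjoin k {y : K | IsIntegral ↥B y}; let tower : Subalgebra k K → ℕ → Subalgebra k K := fun A m => @Nat.rec (fun _ => Subalgebra k K) (loc A) (fun _ B => loc (nrm (chart B))) m; ∃ m : ℕ, IsRegularLocalRing ↥(tower A m)

/-- `NoZeno` is `Persistence → StrictDrop → Termination` on the nose. [folklore] -/
theorem noZeno_iff : NoZeno ↔ (Persistence → StrictDrop → Termination) :=
  ⟨fun h hP hD p hp k K _ _ _ _ O A hk hfg hfr hAO => h hP hD p hp k K O A hk hfg hfr hAO,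
    fun h hP hD p hp k K _ _ _ _ O A hk hfg hfr hAO => h hP hD p hp k K O A hk hfg hfr hAO⟩

/-- **F0 (unfalsifiability in isolation).** A refutation of the crux consists of proofs of BOTH
sibling cruxes and a failure of termination. (Restated from `CruxAttack.not_noZeno_iff`.)
[folklore] -/
theorem not_noZeno_iff' : ¬ NoZeno ↔ Persistence ∧ StrictDrop ∧ ¬ Termination := by
  rw [noZeno_iff]
  constructor
  · intro h
    by_cases hP : Persistence
    · by_cases hD : StrictDrop
      · exact ⟨hP, hD, fun hT => h fun _ _ => hT⟩
      · exact absurd (fun _ hD' => absurd hD' hD) h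
    · exact absurd (fun hP' _ => absurd hP' hP) h
  · rintro ⟨hP, hD, hT⟩ h
    exact hT (h hP hD)

/-- Load-bearing analysis of the two NAMED hypotheses can only be relative: "`NoZeno` without
`Persistence`" is `StrictDrop → Termination`, whose negation again contains a proof of
`StrictDrop`. [folklore] -/
theorem not_noZenoWithoutPersistence_iff :
    ¬ (StrictDrop → Termination) ↔ StrictDrop ∧ ¬ Termination :=
  ⟨fun h => ⟨Classical.byContradiction fun hD => h fun hD' => absurd hD' hD, fun hT => h fun _ => hT⟩,
    fun ⟨hD, hT⟩ h => hT (h hD)⟩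

/-- … and "`NoZeno` without `StrictDrop`" is `Persistence → Termination`. [folklore] -/
theorem not_noZenoWithoutStrictDrop_iff :
    ¬ (Persistence → Termination) ↔ Persistence ∧ ¬ Termination :=
  ⟨fun h => ⟨Classical.byContradiction fun hP => h fun hP' => absurd hP' hP, fun hT => h fun _ => hT⟩,
    fun ⟨hP, hT⟩ h => hT (h hP)⟩

/-! ## F2 — `A.FG` (re-exported pointers; proofs live in the landed Negative file) -/

/-- `A.FG` deleted from the conclusion: FALSE (`A = O` non-noetherian valuation ring, constant
tower). See `NoZenoFalseWithoutFG.lean`. [folklore] -/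
example := @noZeno_termination_false_without_fg

/-- `A.FG` deleted from `StrictDrop`: FALSE at the same witness. [folklore] -/
example := @noZeno_strictDrop_false_without_fg

/-- `A.FG` deleted everywhere: the crux becomes vacuously TRUE. [folklore] -/
example := @noZenoWithoutFG_holds_vacuously

/-! ## F1 — order skeleton (pointers) -/

/-- Positive along noetherian `O` (any badness predicate, no monotonicity). [folklore] -/
example := @noZenoSkeleton_of_isNoetherianRing

/-- Zeno along rank-one non-discrete `O` (`HahnSeries ℚ ℚ`). [folklore] -/
example := @not_noZenoSkeleton_rankOne

/-- Zeno along discrete rank-two `O` (`HahnSeries (ℤ ×ₗ ℤ) ℚ`). [folklore] -/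
example := @not_noZenoSkeleton_discreteRankTwo

/-! ## F3 — stub 1 of line `birth` proved (positive; evidence for the lead) -/

section TowerLe

variable {k K : Type} [Field k] [Field K] [Algebra k K]

/-- `loc B ⊆ O` when `B ⊆ O ∋ k` (verbatim `let loc` body). [folklore] -/
theorem loc_le (O : ValuationSubring K) (O' : Subalgebra k K) (hO' : ∀ x, x ∈ O' ↔ x ∈ O)
    (B : Subalgebra k K) (hB : B ≤ O') :
    Algebra.adjoin k {y : K | ∃ a ∈ B, ∃ s ∈ B, s⁻¹ ∈ O ∧ y = a * s⁻¹} ≤ O' := by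
  refine Algebra.adjoin_le ?_
  rintro y ⟨a, ha, s, -, hsO, rfl⟩
  exact O'.mul_mem (hB ha) ((hO' _).mpr hsO)

/-- `chart B ⊆ O` when `B ⊆ O ∋ k`, for ANY centre set `c` (admissibility clause; verbatim
`let chart` body with `ca B` generalised). [folklore] -/
theorem chart_le (O : ValuationSubring K) (O' : Subalgebra k K) (hO' : ∀ x, x ∈ O' ↔ x ∈ O)
    (B : Subalgebra k K) (hB : B ≤ O') (c : Set K) :
    Algebra.adjoin k ((B : Set K) ∪ {y : K | ∃ c₁ ∈ c, ∃ x ∈ c, x ≠ 0 ∧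
      (∀ c' ∈ c, c' * x⁻¹ ∈ O) ∧ y = c₁ * x⁻¹}) ≤ O' := by
  refine Algebra.adjoin_le ?_
  rintro y (hy | ⟨c₁, hc₁, x, -, -, hadm, rfl⟩)
  · exact hB hy
  · exact (hO' _).mpr (hadm c₁ hc₁)

/-- `nrm B ⊆ O` when `B ⊆ O ∋ k` (valuation rings are integrally closed; verbatim `let nrm`
body). [folklore] -/
theorem nrm_le (O : ValuationSubring K) (O' : Subalgebra k K) (hO' : ∀ x, x ∈ O' ↔ x ∈ O)
    (B : Subalgebra k K) (hB : B ≤ O') :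
    Algebra.adjoin k {y : K | IsIntegral ↥B y} ≤ O' := by
  have hv : O.valuation.Integers ↥O' :=
    { hom_inj := fun a b h => Subtype.ext h
      map_le_one := fun a => (O.valuation_le_one_iff _).mpr ((hO' _).mp a.2)
      exists_of_le_one := fun r hr =>
        ⟨⟨r, (hO' r).mpr ((O.valuation_le_one_iff r).mp hr)⟩, rfl⟩ }
  refine Algebra.adjoin_le ?_
  intro y hy
  letI : Algebra ↥B ↥O' := (Subalgebra.inclusion hB).toRingHom.toAlgebra
  haveI : IsScalarTower ↥B ↥O' K := IsScalarTower.of_algebraMap_eq (fun x => rfl)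
  have hy' : IsIntegral ↥O' y := IsIntegral.tower_top hy
  have h := hv.mem_of_integral hy'
  rw [Valuation.mem_integer_iff] at h
  exact (hO' y).mpr ((O.valuation_le_one_iff y).mp h)

end TowerLe

/-- **Every stage of the canonical tower lies in `O`** (verbatim the route's `let`-tower; uses
only `k ⊆ O` and `A ⊆ O` — no `A.FG`, no `IsFractionRing`, nothing about `ca`). [folklore] -/
theorem tower_le : ∀ (k K : Type) [Field k] [Field K] [Algebra k K] (O : ValuationSubring K) (A : Subalgebra k K), (∀ c : k, algebraMap k K c ∈ O) → A.toSubring ≤ O.toSubring → let ca : Subalgebra k K → Set K := fun A => {x : K | ∃ hx : x ∈ A, ∃ n : ℕ, ∀ i : ℕ, n ≤ i → ∀ (M N : ModuleCat.{0} ↥A), Module.Finite ↥A M → Module.Finite ↥A N → ∀ e : CategoryTheory.Abelian.Ext.{0} M N i, (⟨x, hx⟩ : ↥A) • e = 0}; let loc : Subalgebra k K → Subalgebra k K := fun A => Algebra.adjoin k {y : K | ∃ a ∈ A, ∃ s ∈ A, s⁻¹ ∈ O ∧ y = a * s⁻¹}; let chart : Subalgebra k K → Subalgebra k K := fun A =>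 Algebra.adjoin k ((A : Set K) ∪ {y : K | ∃ c ∈ ca A, ∃ x ∈ ca A, x ≠ 0 ∧ (∀ c' ∈ ca A, c' * x⁻¹ ∈ O) ∧ y = c * x⁻¹}); let nrm : Subalgebra k K → Subalgebra k K := fun B => Algebra.adjoin k {y : K | IsIntegral ↥B y}; let tower : Subalgebra k K → ℕ → Subalgebra k K := fun A m => @Nat.rec (fun _ => Subalgebra k K) (loc A) (fun _ B => loc (nrm (chart B))) m; ∀ m : ℕ, ∀ x : K, x ∈ tower A m → x ∈ O := by
  intro k K _ _ _ O A hk hAO ca loc chart nrm tower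
  let O' : Subalgebra k K := { O.toSubring.toSubsemiring with algebraMap_mem' := hk }
  have hO' : ∀ x, x ∈ O' ↔ x ∈ O := fun x => Iff.rfl
  have hA : A ≤ O' := fun x hx => hAO hx
  suffices h : ∀ m, tower A m ≤ O' from fun m x hx => (hO' x).mp (h m hx)
  intro m
  induction m with
  | zero => exact loc_le O O' hO' A hA
  | succ n ih =>
    show loc (nrm (chart (tower A n))) ≤ O'
    exact loc_le O O' hO' _ (nrm_le O O' hO' _ (chart_le O O' hO' _ ih (ca (tower A n))))

/-- **Stub 1 (`stub_noetherianCase`) of line `birth`, PROVED.** `StrictDrop` alone forces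
termination of the canonical tower along every NOETHERIAN valuation ring (a field or a DVR):
`T_m ⊆ O` (`tower_le`) plus the landed order skeleton `noZenoSkeleton_of_isNoetherianRing` with
`Bad m := ¬ IsRegularLocalRing (T_m)` and `c m := ca(T_m)`. `Persistence` is not used; `A.FG` and
`IsFractionRing` only feed `StrictDrop`. Let-form over the verbatim tower: convert to
`Lines.Birth.Sig.stub_noetherianCase` by unfolding `Birth.tower` (δ) and reordering the
hypothesis `IsNoetherianRing ↥O`. [cite: ZariskiSamuel1960, Ch. VI §10] -/
theorem stub_noetherianCase_proof (hD : StrictDrop) : ∀ p : ℕ, p.Prime → ∀ (k K : Type) [Field k] [CharP k p] [Field K] [Algebra k K] (O : ValuationSubring K) (A : Subalgebra k K), (∀ c : k, algebraMap k K c ∈ O) → A.FG → IsFractionRing ↥A K → A.toSubring ≤ O.toSubring → IsNoetherianRing ↥O → let ca : Subalgebra k K → Set K := fun A => {x : K | ∃ hx : x ∈ A, ∃ n : ℕ, ∀ i : ℕ, n ≤ i → ∀ (M N : ModuleCat.{0} ↥A), Module.Finite ↥A M → Module.Finite ↥A N → ∀ e : CategoryTheory.Abelian.Ext.{0} M N i,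 (⟨x, hx⟩ : ↥A) • e = 0}; let loc : Subalgebra k K → Subalgebra k K := fun A => Algebra.adjoin k {y : K | ∃ a ∈ A, ∃ s ∈ A, s⁻¹ ∈ O ∧ y = a * s⁻¹}; let chart : Subalgebra k K → Subalgebra k K := fun A => Algebra.adjoin k ((A : Set K) ∪ {y : K | ∃ c ∈ ca A, ∃ x ∈ ca A, x ≠ 0 ∧ (∀ c' ∈ ca A, c' * x⁻¹ ∈ O) ∧ y = c * x⁻¹}); let nrm : Subalgebra k K → Subalgebra k K := fun B => Algebra.adjoin k {y : K | IsIntegral ↥B y}; let tower : Subalgebra k K → ℕ → Subalgebra k K := fun A m => @Nat.rec (fun _ => Subalgebra k K) (loc A) (fun _ B => loc (nrm (chart B))) m; ∃ m : ℕ, IsRegularLocalRing ↥(tower A m) := by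
  intro p hp k K _ _ _ _ O A hk hfg hfr hAO hN ca loc chart nrm tower
  have hsub := tower_le k K O A hk hAO
  have hdrop := hD p hp k K O A hk hfg hfr hAO
  obtain ⟨m, hm⟩ := noZenoSkeleton_of_isNoetherianRing O hN
    (fun m => ¬ IsRegularLocalRing ↥(tower A m)) (fun m => ca (tower A m))
    (fun m x hx => hsub m x hx.1) hdrop
  exact ⟨m, not_not.mp hm⟩

/-! ## NEAR-MISSES / open regimes for the next cycle (no `sorry` carried: nothing was close)

* (done, F1′) the order skeleton for `O` ⟺ `IsNoetherianRing O`.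
* ARITHMETIC skeleton for stub 2 (the statement a prover would want): if the values `γ_m` lie in
  `(1/N)·Λ` for a FIXED discrete subgroup `Λ ⊂ ℝ` (bounded denominators), drops force `γ = 0`.
  True and easy; the content of `stub_rankOneCase` is whether `ca(T_m)` has bounded denominators
  along the tower — for rational rank ≥ 2 (Abhyankar, value group `ℤ + ℤ√2 ⊂ ℝ`) even a finitely
  generated value group admits Zeno sequences (`(√2 − 1)^m ↓ 0`), so "bounded denominators" must
  be read inside a rank-one DISCRETE lattice, which such `v(K×)` is not: the prover needs a
  different invariant there (e.g. termination of the residue-transcendence / Abhyankar case by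
  Knaf–Kuhlmann-type monomialisation of `ca`), not a denominator bound.
* Realisation lemma (CruxAttack S2(i)): an infinite chain of singular points in iterated
  normalised `ca`-blow-ups is the tower of some valuation ring — would let a route kill dispense
  with valuation theory; needs existence of dominating valuation rings (Chevalley) over the tower
  union. Not attempted in Lean.
* Toric `ca` test-bed (Why-it-resists 4): needs a formula for `ca(k[S])`; none known.
-/

end Summit.ResolutionOfSingularities.ResolutionOfSingularities.Cruxes.NoZeno.Disproof

end
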